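import Summits.ValiantsHypothesis.ValiantsHypothesis.Theorems.DivisionGapPerDivisionHardStubTorusFamily
import Summits.ValiantsHypothesis.ValiantsHypothesis.Theorems.DivisionGapPerDivisionHardStubSparseFamilyRigid
import Summits.ValiantsHypothesis.ValiantsHypothesis.Theorems.DivisionGapPerDivisionHardStubFaceDescent
import Summits.ValiantsHypothesis.ValiantsHypothesis.Theorems.DivisionGapPerDivisionHardStubJssContraction
import Summits.ValiantsHypothesis.ValiantsHypothesis.Theorems.DivisionGapPerDivisionHardStubBlockArsenal

/-!
# Crux `DivisionGap.PerDivisionHard` (stmt-ValiantsHypothesis-5065) — the PRODUCT-OF-SPARSE-FACTORS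
RUNG, unconditionally

`PerDivisionHard` asks, for every `c` and all large `n`, that every nonzero cofactor
`h ∈ ℝ≥0[x_ij]` satisfies `2^{(log₂ n + c)^c} < L(per_n · h) + L(h)` (monotone fan-in-two
`complexity` over `ℝ≥0`).  This file proves it for every cofactor that is a finite PRODUCT
`h = ∏_{j ∈ J} q j` of nonzero factors of quasi-polynomially bounded TOTAL support:

* `perDivisionHard_sparseProduct` — **∀ c, ∃ n₀, ∀ n ≥ n₀, for every finite family `(q j)_{j ∈ J}`
  of nonzero polynomials with `Σ_j |supp (q j)| ≤ 2^{(log₂ n + c)^c}`: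
  `2^{(log₂ n + c)^c} < L(per_n · ∏ q j) + L(∏ q j)`.**

Such products are in general NOT sparse as polynomials (up to `2^{Σ_j log |supp q_j|}` monomials)
and have degree close to `n` or beyond, so neither the sparse rung `perDivisionHard_sparse` nor any
degree-based rung (`PerLowDegreeRung.two_pow_le_complexity_perPoly_mul`, `deg h ≤ n - 6`) reaches
them.  Covered in particular are the test cofactors of the crux's idea cards: the cycle products
`U_ℓ = ∏_{|C| ≤ ℓ} (x^{C⁺} + x^{C⁻})` over the short cycles of `K_{n,n}`, the "universal exchange"
cofactor `h_L` (`L ≈ 4 log₂ n`, `n^{O(log n)}` binomial factors), and products of relabelled small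
permanents / band permanents.

Proof: the composition of `perDivisionHard_sparse` (`Theorems/DivisionGapPerDivisionHardSparse.lean`)
with the family versions of its first two stubs.  Factorwise torus normal form keeping sub-supports
(`stub_torusFamily`) → ONE placement of the subdivided block `G(b,k) ⊕ M₀` and ONE weight `w`
cutting out the placed face for which EVERY factor has a single `G`-part `u j`
(`stub_sparseFamilyRigid`) → the product has the single `G`-part `Σ_j u j`
(`exists_hasSingleGPart_finset_prod`: top components are multiplicative over `ℝ≥0`,
`topComponent_mul`, and `supp (f · g) ⊆ supp f + supp g`) → face descent to `x^u · per_G`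
(`stub_faceDescent`) → the monomial is stripped at polynomial cost (`stub_jssContraction`,
Jukna–Seiwert–Sergeev) → the placed face is harder than that (`stub_blockArsenal`, Jerrum–Snir by
support through the phase bijection).  What remains of the crux is the registered open stub K2′
(`stub_noCheapOmnipresence`: dense, non-product cofactors).
-/

noncomputable section

-- `Summit.ValiantsHypothesis.ValiantsHypothesis.…` is the tree's mandated single-conjunct layout
-- (Sub = Summit), so the duplicated namespace component is intended.
set_option linter.dupNamespace false

namespace Summit.ValiantsHypothesis.ValiantsHypothesis.Theorems.DivisionGapPerDivisionHard

open MvPolynomial Literature.Computability.AlgebraicComplexity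
open Summit.ValiantsHypothesis.ValiantsHypothesis.Theorems.ZeroOneTransfer.Negative
open scoped NNReal

variable {n : ℕ}

/-! ### Single `G`-parts multiply -/

/-- The constant `1` has the single `G`-part `0` (`top_w 1 = 1`, `supp 1 = {0}`). [folklore] -/
theorem hasSingleGPart_one (G : Finset (Fin n × Fin n)) (w : Fin n × Fin n → ℕ) :
    HasSingleGPart G w 1 0 := by
  refine ⟨by simp, fun m hm e _ => ?_⟩
  rw [topComponent_one, support_one, Finset.mem_singleton] at hm
  rw [hm]

/-- **Single `G`-parts multiply**: if the top-`w` fibres of `f` and `g` restrict to `u₁` and `u₂`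
on `G`, the top-`w` fibre of `f · g` restricts to `u₁ + u₂` (top components are multiplicative
over `ℝ≥0`, `topComponent_mul`, and `supp (f · g) ⊆ supp f + supp g`). [folklore] -/
theorem HasSingleGPart.mul {G : Finset (Fin n × Fin n)} {w : Fin n × Fin n → ℕ}
    {f g : MvPolynomial (Fin n × Fin n) ℝ≥0} {u₁ u₂ : (Fin n × Fin n) →₀ ℕ}
    (hf : HasSingleGPart G w f u₁) (hg : HasSingleGPart G w g u₂) :
    HasSingleGPart G w (f * g) (u₁ + u₂) := by
  classical
  refine ⟨Finsupp.support_add.trans (Finset.union_subset hf.1 hg.1), fun m hm e he => ?_⟩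
  rw [topComponent_mul] at hm
  obtain ⟨m₁, hm₁, m₂, hm₂, rfl⟩ := Finset.mem_add.mp (support_mul _ _ hm)
  rw [Finsupp.add_apply, Finsupp.add_apply, hf.2 m₁ hm₁ e he, hg.2 m₂ hm₂ e he]

/-- **A finite product of polynomials with single `G`-parts has a single `G`-part** (the sum of
the parts). [folklore] -/
theorem exists_hasSingleGPart_finset_prod {ι : Type*} (G : Finset (Fin n × Fin n))
    (w : Fin n × Fin n → ℕ) (s : Finset ι) (f : ι → MvPolynomial (Fin n × Fin n) ℝ≥0)
    (h : ∀ j ∈ s, ∃ u : (Fin n × Fin n) →₀ ℕ, HasSingleGPart G w (f j) u) :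
    ∃ u : (Fin n × Fin n) →₀ ℕ, HasSingleGPart G w (∏ j ∈ s, f j) u := by
  classical
  induction s using Finset.induction_on with
  | empty => exact ⟨0, by rw [Finset.prod_empty]; exact hasSingleGPart_one G w⟩
  | insert a s ha ih =>
    obtain ⟨u₁, hu₁⟩ := h a (Finset.mem_insert_self a s)
    obtain ⟨u₂, hu₂⟩ := ih fun j hj => h j (Finset.mem_insert_of_mem hj)
    exact ⟨u₁ + u₂, by rw [Finset.prod_insert ha]; exact hu₁.mul hu₂⟩

/-! ### The rung -/

/-- **The product-of-sparse-factors rung of `PerDivisionHard`.**  For every `c` there is `n₀` such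
that for all `n ≥ n₀` and every finite family `(q j)_{j ∈ J}` of nonzero `q j ∈ ℝ≥0[x_ij]`
(`n × n` matrix variables) of total support `Σ_{j ∈ J} |supp (q j)| ≤ 2^{(log₂ n + c)^c}`,
`2^{(log₂ n + c)^c} < L(per_n · ∏_j q j) + L(∏_j q j)` in the monotone fan-in-two `complexity`
over `ℝ≥0`: the permanent admits no quasi-polynomially cheap monotone pair whose cofactor is a
product of sparse factors, whatever its degree and however many monomials the product has —
e.g. the cycle products `U_ℓ = ∏_{|C| ≤ ℓ} (x^{C⁺} + x^{C⁻})`, the universal exchange cofactor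
`h_L` (`n^{O(log n)}` binomial factors), products of relabelled small permanents.  Composition of
the landed stubs of line `pair-descent-jss-endpoint`: factorwise torus normal form with
sub-supports, family rigidity of one placed subdivided block face, multiplicativity of single
`G`-parts, face descent, Jukna–Seiwert–Sergeev contraction, hardness of the block face. -/
theorem perDivisionHard_sparseProduct :
    ∀ c : ℕ, ∃ n₀ : ℕ, ∀ n ≥ n₀, ∀ (ι : Type) (J : Finset ι)
      (q : ι → MvPolynomial (Fin n × Fin n) ℝ≥0),
      (∀ j ∈ J, q j ≠ 0) → (∑ j ∈ J, (q j).support.card) ≤ 2 ^ ((Nat.log 2 n + c) ^ c) →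
      2 ^ ((Nat.log 2 n + c) ^ c) <
        complexity (perPoly (Fin n) ℝ≥0 * ∏ j ∈ J, q j) + complexity (∏ j ∈ J, q j) := by
  intro c
  obtain ⟨κ, hcon⟩ := stub_jssContraction
  obtain ⟨d, n₁, hhard⟩ := stub_blockArsenal c κ
  obtain ⟨n₀, hS⟩ := stub_sparseFamilyRigid c d
  refine ⟨n₀ + n₁, ?_⟩
  intro n hn ι J q hq hcard
  -- factorwise torus normal form, keeping sub-supports
  obtain ⟨q', hq', htor, hsupp, hle1, -⟩ := stub_torusFamily n ι J q hq
  by_contra hlt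
  have hle : complexity (perPoly (Fin n) ℝ≥0 * ∏ j ∈ J, q j) + complexity (∏ j ∈ J, q j) ≤
      2 ^ ((Nat.log 2 n + c) ^ c) := not_lt.mp hlt
  have hcard' : (∑ j ∈ J, (q' j).support.card) ≤ 2 ^ ((Nat.log 2 n + c) ^ c) :=
    le_trans (Finset.sum_le_sum fun j hj => Finset.card_le_card (hsupp j hj)) hcard
  -- one placement and one weight for the whole family; single `G`-parts factor by factor
  obtain ⟨b, k, m, eR, eC, w, hb, hcut, hfam⟩ := hS n (by omega) ι J q' hq' htor hcard'
  -- the product `h' = ∏ q' j` is nonzero and has a single `G`-part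
  have hh' : (∏ j ∈ J, q' j) ≠ 0 := Finset.prod_ne_zero_iff.mpr hq'
  obtain ⟨u, hsingle⟩ := exists_hasSingleGPart_finset_prod (placedBlock eR eC) w J q' hfam
  -- face descent: `x^u · per_G` is (up to one gate) no more expensive than `per · h'`
  have hdesc := stub_faceDescent n (placedBlock eR eC) w (∏ j ∈ J, q' j) u hcut hh' hsingle
  have h1 : complexity (monomial u (1 : ℝ≥0) * facePer (placedBlock eR eC)) ≤
      2 ^ ((Nat.log 2 n + c) ^ c) + 1 :=
    calc complexity (monomial u (1 : ℝ≥0) * facePer (placedBlock eR eC))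
        ≤ complexity (perPoly (Fin n) ℝ≥0 * ∏ j ∈ J, q' j) + 1 := hdesc
      _ ≤ complexity (perPoly (Fin n) ℝ≥0 * ∏ j ∈ J, q j) + 1 := Nat.add_le_add_right hle1 1
      _ ≤ 2 ^ ((Nat.log 2 n + c) ^ c) + 1 :=
          Nat.add_le_add_right (le_trans (Nat.le_add_right _ _) hle) 1
  -- JSS contraction: strip the monomial at polynomial cost
  have h2 : complexity (facePer (placedBlock eR eC)) ≤
      ((n + 2) * (2 ^ ((Nat.log 2 n + c) ^ c) + 3)) ^ κ :=
    calc complexity (facePer (placedBlock eR eC))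
        ≤ ((n + 2) * (complexity (monomial u (1 : ℝ≥0) * facePer (placedBlock eR eC)) + 2)) ^ κ :=
          hcon n (facePer (placedBlock eR eC)) u
      _ ≤ ((n + 2) * (2 ^ ((Nat.log 2 n + c) ^ c) + 3)) ^ κ :=
          Nat.pow_le_pow_left (Nat.mul_le_mul_left _ (by omega)) κ
  -- the placed block face is harder than that
  have h3 := hhard n (by omega) b k m eR eC hb
  exact absurd (lt_of_lt_of_le h3 h2) (lt_irrefl _)

end Summit.ValiantsHypothesis.ValiantsHypothesis.Theorems.DivisionGapPerDivisionHard

end
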